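import Literature.MathematicalPhysics.QuantumLattice.AbelianFluxSectorsProofs
import HarnessLib

/-!
# Lüscher's abelian lattice field tensor and the `ε F F` charge density of the flux sectors

Definitions (with bodies) and proved theorems vendoring the vocabulary of

* [Luscher1999AbelianTopology] M. Lüscher, *Topology and the axial anomaly in abelian lattice
  gauge theories*, Nucl. Phys. B 538 (1999) 515, arXiv:hep-lat/9808021, §3 eqs. (3.3)–(3.5) and
  eq. (1.4): for a compact `U(1)` lattice gauge field the **field tensor** is
  `F_{μν}(x) = (1/i) ln P(x,μ,ν)`, `−π < F_{μν}(x) ≤ π`, with `P` the plaquette holonomy (3.3);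
  *admissible* fields are those with `sup |F_{μν}(x)| < ε` (3.5); the topological term of the
  classification theorem (1.4) is `ε_{μνρσ} F_{μν}(x) F_{ρσ}(x + μ̂ + ν̂)`, with coefficient
  `γ = n/(32π²)` in the case of the axial anomaly (7.1);
* [Luscher1999AbelianChiral] M. Lüscher, Nucl. Phys. B 549 (1999) 295, arXiv:hep-lat/9811032,
  §2.1–2.2 and §7.2: the same field tensor on the periodic lattice, and the statement that the
  flux-sector field `V_{[m]}` "has constant field tensor equal to `2π m_{μν}/L²`";
* [IgarashiOkuyamaSuzuki2002] eq. (3.4) and [Fujiwara2002SpectralFlow]: on such a field the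
  `ε F F` charge sums to `(1/8) ε_{μνρσ} m_{μν} m_{ρσ} = m₀₁ m₂₃ − m₀₂ m₁₃ + m₀₃ m₁₂`.

on the tree's periodic torus `TorusSite d L`, for `U(1) = Circle`-valued gauge fields
(`GaugeConfig d L Circle`, plaquette `plaquetteHolonomy`, flux-sector field `fluxSectorField` of
`AbelianFluxSectors.lean`).

Contents:

* `abelianFieldTensor U x μ ν = Complex.arg (P(x,μ,ν))` — Lüscher's `F_{μν}(x) ∈ (−π, π]`, with
  `Circle.exp (F) = P` (`exp_abelianFieldTensor`), the range lemmas, and the **chord–arc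
  comparison** with the tree's norm-admissibility `‖1 − ρ(P)‖`:
  `‖1 − P‖ = 2|sin(F/2)|`, `‖1 − P‖ ≤ |F| ≤ (π/2)‖1 − P‖`
  (`norm_one_sub_coe_plaquette_eq`, `norm_one_sub_plaquette_le_abs_abelianFieldTensor`,
  `abs_abelianFieldTensor_le`), so `‖1 − u1Rep P‖ ≤ δ` gives `|F| ≤ πδ/2`
  (`abs_abelianFieldTensor_le_of_norm_one_sub_u1Rep_le`);
* `abelianFieldTensor_fluxSectorField` — **constant field tensor of `V_{[m]}`**:
  `F_{μν}(V_{[m]}) = 2π m_{μν}/L²` whenever `2|m_{μν}| < L²` [Luscher1999AbelianChiral, §7.2];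
* `leviCivita4` (the sign-product formula `Π_{i<j} sgn(a_j − a_i)`) and
  `epsFF U x = Σ ε_{μνρσ} F_{μν}(x) F_{ρσ}(x+μ̂+ν̂)` — the quadratic density of (1.4);
* `sum_leviCivita4_mul_mul` — `Σ ε_{μνρσ} m_{μν} m_{ρσ} = 8 (m₀₁m₂₃ − m₀₂m₁₃ + m₀₃m₁₂)` for
  antisymmetric `m`; `epsFF_fluxSectorField`, `sum_epsFF_fluxSectorField` — on `V_{[m]}`,
  `(1/32π²) Σ_{x∈Γ} ε F F = m₀₁ m₂₃ − m₀₂ m₁₃ + m₀₃ m₁₂`, the integer on the right of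
  `IOSFluxSectorIndex`.

No named facts are introduced.

## References

* M. Lüscher, Nucl. Phys. B 538 (1999) 515–529, arXiv:hep-lat/9808021, §3 (3.3)–(3.5), (1.4),
  (7.1). [Luscher1999AbelianTopology]
* M. Lüscher, Nucl. Phys. B 549 (1999) 295–334, arXiv:hep-lat/9811032, §2.1–2.2, §7.2.
  [Luscher1999AbelianChiral]
* H. Igarashi, K. Okuyama, H. Suzuki, Nucl. Phys. B 644 (2002) 383, arXiv:hep-lat/0206003,
  eq. (3.4). [IgarashiOkuyamaSuzuki2002]
-/

noncomputable section

open Finset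
open Literature.Probability.LatticeModels (TorusSite)
open Literature.MathematicalPhysics.QuantumFieldTheory

namespace Literature.MathematicalPhysics.QuantumLattice

/-! ### The field tensor `F_{μν}(x) = (1/i) ln P(x,μ,ν) ∈ (−π, π]` -/

section FieldTensor

open scoped Matrix.Norms.L2Operator

variable {d L : ℕ}

/-- **Lüscher's abelian lattice field tensor** `F_{μν}(x) = (1/i) ln P(x,μ,ν)`, the principal
logarithm (`−π < F ≤ π`) of the plaquette holonomy of a `U(1)` lattice gauge field.
[cite: Luscher1999AbelianTopology, eqs. (3.3)–(3.4)] -/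
def abelianFieldTensor (U : GaugeConfig d L Circle) (x : TorusSite d L) (μ ν : Fin d) : ℝ :=
  Complex.arg ((plaquetteHolonomy U x μ ν : Circle) : ℂ)

/-- `−π < F_{μν}(x)`. [cite: Luscher1999AbelianTopology, eq. (3.4)] -/
theorem neg_pi_lt_abelianFieldTensor (U : GaugeConfig d L Circle) (x : TorusSite d L)
    (μ ν : Fin d) : -Real.pi < abelianFieldTensor U x μ ν :=
  Complex.neg_pi_lt_arg _

/-- `F_{μν}(x) ≤ π`. [cite: Luscher1999AbelianTopology, eq. (3.4)] -/
theorem abelianFieldTensor_le_pi (U : GaugeConfig d L Circle) (x : TorusSite d L) (μ ν : Fin d) :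
    abelianFieldTensor U x μ ν ≤ Real.pi :=
  Complex.arg_le_pi _

/-- `|F_{μν}(x)| ≤ π`. [cite: Luscher1999AbelianTopology, eq. (3.4)] -/
theorem abs_abelianFieldTensor_le_pi (U : GaugeConfig d L Circle) (x : TorusSite d L)
    (μ ν : Fin d) : |abelianFieldTensor U x μ ν| ≤ Real.pi :=
  abs_le.mpr ⟨(neg_pi_lt_abelianFieldTensor U x μ ν).le, abelianFieldTensor_le_pi U x μ ν⟩

/-- `P(x,μ,ν) = exp(i F_{μν}(x))`. [cite: Luscher1999AbelianTopology, eq. (3.4)] -/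
theorem exp_abelianFieldTensor (U : GaugeConfig d L Circle) (x : TorusSite d L) (μ ν : Fin d) :
    Circle.exp (abelianFieldTensor U x μ ν) = plaquetteHolonomy U x μ ν :=
  Circle.exp_arg _

/-- The field tensor is determined by the plaquette: if `P = exp(iθ)` with `−π < θ ≤ π` then
`F = θ`. [cite: Luscher1999AbelianTopology, eq. (3.4)] -/
theorem abelianFieldTensor_eq_of_plaquette_eq_exp {U : GaugeConfig d L Circle} {x : TorusSite d L}
    {μ ν : Fin d} {θ : ℝ} (h : plaquetteHolonomy U x μ ν = Circle.exp θ) (h₁ : -Real.pi < θ)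
    (h₂ : θ ≤ Real.pi) : abelianFieldTensor U x μ ν = θ := by
  rw [abelianFieldTensor, h]
  exact Circle.arg_exp h₁ h₂

/-- **Chord versus arc.** `‖1 − exp(iθ)‖ = 2|sin(θ/2)|`. [folklore] -/
theorem norm_one_sub_cexp_mul_I (θ : ℝ) :
    ‖(1 : ℂ) - Complex.exp (θ * Complex.I)‖ = 2 * |Real.sin (θ / 2)| := by
  have hcos : Real.cos θ = 1 - 2 * Real.sin (θ / 2) ^ 2 := by
    have h := Real.cos_sq (θ / 2)
    rw [mul_div_cancel₀ θ two_ne_zero] at h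
    nlinarith [Real.sin_sq_add_cos_sq (θ / 2)]
  have hsq : ‖(1 : ℂ) - Complex.exp (θ * Complex.I)‖ ^ 2 = (2 * |Real.sin (θ / 2)|) ^ 2 := by
    rw [Complex.sq_norm, Complex.normSq_apply, Complex.sub_re, Complex.sub_im, Complex.one_re,
      Complex.one_im, Complex.exp_ofReal_mul_I_re, Complex.exp_ofReal_mul_I_im, mul_pow, sq_abs]
    nlinarith [Real.sin_sq_add_cos_sq θ]
  have h1 : 0 ≤ ‖(1 : ℂ) - Complex.exp (θ * Complex.I)‖ := norm_nonneg _
  have h2 : 0 ≤ 2 * |Real.sin (θ / 2)| := by positivity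
  nlinarith [hsq]

/-- `‖1 − P(x,μ,ν)‖ = 2|sin(F_{μν}(x)/2)|`. [folklore] -/
theorem norm_one_sub_coe_plaquette_eq (U : GaugeConfig d L Circle) (x : TorusSite d L)
    (μ ν : Fin d) : ‖(1 : ℂ) - ((plaquetteHolonomy U x μ ν : Circle) : ℂ)‖ =
      2 * |Real.sin (abelianFieldTensor U x μ ν / 2)| := by
  conv_lhs => rw [← exp_abelianFieldTensor U x μ ν, Circle.coe_exp]
  exact norm_one_sub_cexp_mul_I _

/-- Chord ≤ arc: `‖1 − P‖ ≤ |F|`. [folklore] -/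
theorem norm_one_sub_plaquette_le_abs_abelianFieldTensor (U : GaugeConfig d L Circle)
    (x : TorusSite d L) (μ ν : Fin d) :
    ‖(1 : ℂ) - ((plaquetteHolonomy U x μ ν : Circle) : ℂ)‖ ≤ |abelianFieldTensor U x μ ν| := by
  rw [norm_one_sub_coe_plaquette_eq]
  have h := Real.abs_sin_le_abs (x := abelianFieldTensor U x μ ν / 2)
  rw [abs_div, abs_two] at h
  linarith

/-- Arc ≤ (π/2) chord on the principal branch: `|F| ≤ (π/2) ‖1 − P‖` (Jordan's inequality
`sin t ≥ 2t/π` on `[0, π/2]` at `t = |F|/2`). [folklore] -/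
theorem abs_abelianFieldTensor_le (U : GaugeConfig d L Circle) (x : TorusSite d L) (μ ν : Fin d) :
    |abelianFieldTensor U x μ ν| ≤ Real.pi / 2 * ‖(1 : ℂ) - ((plaquetteHolonomy U x μ ν : Circle) : ℂ)‖ := by
  rw [norm_one_sub_coe_plaquette_eq]
  set F := abelianFieldTensor U x μ ν with hF
  have hFπ : |F| ≤ Real.pi := abs_abelianFieldTensor_le_pi U x μ ν
  have h0 : 0 ≤ |F| / 2 := by positivity
  have hle : |F| / 2 ≤ Real.pi / 2 := by linarith
  have hj := Real.mul_le_sin h0 hle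
  -- `|sin (F/2)| = sin (|F|/2)`
  have hFle : F ≤ Real.pi := (le_abs_self F).trans hFπ
  have hFge : -F ≤ Real.pi := (neg_le_abs F).trans hFπ
  have habs : |Real.sin (F / 2)| = Real.sin (|F| / 2) := by
    rcases le_or_gt 0 F with hF0 | hF0
    · rw [abs_of_nonneg hF0, abs_of_nonneg]
      exact Real.sin_nonneg_of_nonneg_of_le_pi (by positivity) (by linarith)
    · rw [abs_of_neg hF0, neg_div, Real.sin_neg, abs_of_nonpos]
      have : Real.sin (-F / 2) = - Real.sin (F / 2) := by rw [neg_div, Real.sin_neg]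
      have h' : 0 ≤ Real.sin (-F / 2) :=
        Real.sin_nonneg_of_nonneg_of_le_pi (by linarith) (by linarith)
      linarith
  rw [habs]
  have hpi : 0 < Real.pi := Real.pi_pos
  -- from `2/π · (|F|/2) ≤ sin(|F|/2)`
  have : |F| / Real.pi ≤ Real.sin (|F| / 2) := by
    calc |F| / Real.pi = 2 / Real.pi * (|F| / 2) := by ring
      _ ≤ Real.sin (|F| / 2) := hj
  calc |F| = Real.pi * (|F| / Real.pi) := by field_simp
    _ ≤ Real.pi * Real.sin (|F| / 2) := mul_le_mul_of_nonneg_left this hpi.le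
    _ = Real.pi / 2 * (2 * Real.sin (|F| / 2)) := by ring

/-- The tree's norm-admissibility controls Lüscher's: `‖1 − u1Rep P‖ ≤ δ` (the `1 × 1` matrix norm
used by `wilsonDirac_normSq_mulVec_ge_of_plaquette`) gives `|F| ≤ πδ/2`. [folklore] -/
theorem abs_abelianFieldTensor_le_of_norm_one_sub_u1Rep_le (U : GaugeConfig d L Circle)
    (x : TorusSite d L) (μ ν : Fin d) {δ : ℝ}
    (h : ‖(1 : Matrix (Fin 1) (Fin 1) ℂ) - u1Rep (plaquetteHolonomy U x μ ν)‖ ≤ δ) :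
    |abelianFieldTensor U x μ ν| ≤ Real.pi / 2 * δ := by
  have hnorm : ‖(1 : Matrix (Fin 1) (Fin 1) ℂ) - u1Rep (plaquetteHolonomy U x μ ν)‖ =
      ‖(1 : ℂ) - ((plaquetteHolonomy U x μ ν : Circle) : ℂ)‖ := by
    rw [u1Rep_apply, ← map_one (Matrix.scalar (Fin 1)), ← map_sub, Matrix.scalar_apply,
      Matrix.l2_opNorm_diagonal]
    exact pi_norm_const (ι := Fin 1) _
  refine (abs_abelianFieldTensor_le U x μ ν).trans ?_
  rw [← hnorm]
  exact mul_le_mul_of_nonneg_left h (by positivity)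

end FieldTensor

/-! ### The flux-sector field has constant field tensor `2π m_{μν}/L²` -/

section FluxSector

variable {L : ℕ} [NeZero L]

/-- **Lüscher, §7.2**: the flux-sector field `V_{[m]}` has constant field tensor
`F_{μν}(x) = 2π m_{μν}/L²` (for an antisymmetric integer tensor `m` with `2|m_{μν}| < L²`, so that
`2π m_{μν}/L²` lies on the principal branch). [cite: Luscher1999AbelianChiral, §7.2] -/
theorem abelianFieldTensor_fluxSectorField (m : Fin 4 → Fin 4 → ℤ) (hm : ∀ μ ν, m ν μ = -m μ ν)
    (x : TorusSite 4 L) (μ ν : Fin 4) (hb : 2 * |(m μ ν : ℝ)| < (L : ℝ) ^ 2) :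
    abelianFieldTensor (fluxSectorField L m) x μ ν = 2 * Real.pi * (m μ ν : ℝ) / (L : ℝ) ^ 2 := by
  have hL : (0 : ℝ) < (L : ℝ) ^ 2 := by
    have : (0 : ℝ) < L := Nat.cast_pos.mpr (NeZero.pos L)
    positivity
  have hπ := Real.pi_pos
  have habs : |2 * Real.pi * (m μ ν : ℝ) / (L : ℝ) ^ 2| < Real.pi := by
    rw [abs_div, abs_of_pos hL, div_lt_iff₀ hL, abs_mul, abs_of_pos (by positivity : (0:ℝ) < 2 * Real.pi)]
    nlinarith
  refine abelianFieldTensor_eq_of_plaquette_eq_exp (plaquetteHolonomy_fluxSectorField m hm x μ ν)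
    ?_ (abs_lt.mp habs).2.le
  exact (abs_lt.mp habs).1

end FluxSector

/-! ### The `ε_{μνρσ} F_{μν}(x) F_{ρσ}(x+μ̂+ν̂)` density -/

section Charge

/-- The four-index Levi-Civita symbol through the sign-product formula
`ε_{a₀a₁a₂a₃} = Π_{i<j} sgn(a_j − a_i)` (`= ±1` on permutations, `0` otherwise). [folklore] -/
def leviCivita4 (a : Fin 4 → Fin 4) : ℤ :=
  ∏ i : Fin 4, ∏ j ∈ Finset.Ioi i, Int.sign ((a j : ℤ) - (a i : ℤ))

/-- `ε₀₁₂₃ = 1`. [folklore] -/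
theorem leviCivita4_id : leviCivita4 ![0, 1, 2, 3] = 1 := by decide

/-- `ε₁₀₂₃ = −1`. [folklore] -/
theorem leviCivita4_swap : leviCivita4 ![1, 0, 2, 3] = -1 := by decide

/-- `ε` vanishes on a repeated index. [folklore] -/
theorem leviCivita4_of_eq_zero_one (a : Fin 4 → Fin 4) (h : a 0 = a 1) : leviCivita4 a = 0 := by
  unfold leviCivita4
  rw [Fin.prod_univ_four]
  have : ∏ j ∈ Finset.Ioi (0 : Fin 4), Int.sign ((a j : ℤ) - (a 0 : ℤ)) = 0 := by
    refine Finset.prod_eq_zero (i := 1) (by decide) ?_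
    rw [h, sub_self, Int.sign_zero]
  rw [this]
  ring

variable {L : ℕ}

/-- **The quadratic density of Lüscher's theorem (1.4)**:
`(εFF)(x) = Σ_{μνρσ} ε_{μνρσ} F_{μν}(x) F_{ρσ}(x + μ̂ + ν̂)`. [cite: Luscher1999AbelianTopology, eq. (1.4)] -/
def epsFF (U : GaugeConfig 4 L Circle) (x : TorusSite 4 L) : ℝ :=
  ∑ μ : Fin 4, ∑ ν : Fin 4, ∑ ρ : Fin 4, ∑ σ : Fin 4,
    (leviCivita4 ![μ, ν, ρ, σ] : ℝ) * abelianFieldTensor U x μ ν *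
      abelianFieldTensor U ((Site.shift x μ).shift ν) ρ σ

/-- **`Σ ε_{μνρσ} m_{μν} m_{ρσ} = 8 (m₀₁ m₂₃ − m₀₂ m₁₃ + m₀₃ m₁₂)`** for an antisymmetric tensor
`m` (the `d = 4` case of the combinatorial factor `(−1)^{d/2} 2^{d/2} (d/2)!` relating
`ε m⋯m` to the Pfaffian in IOS (3.4)). [cite: IgarashiOkuyamaSuzuki2002, eq. (3.4)] -/
theorem sum_leviCivita4_mul_mul (m : Fin 4 → Fin 4 → ℝ) (hm : ∀ μ ν, m ν μ = -m μ ν) :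
    ∑ μ : Fin 4, ∑ ν : Fin 4, ∑ ρ : Fin 4, ∑ σ : Fin 4,
        (leviCivita4 ![μ, ν, ρ, σ] : ℝ) * m μ ν * m ρ σ =
      8 * (m 0 1 * m 2 3 - m 0 2 * m 1 3 + m 0 3 * m 1 2) := by
  have h00 : m 0 0 = 0 := by have := hm 0 0; linarith
  have h11 : m 1 1 = 0 := by have := hm 1 1; linarith
  have h22 : m 2 2 = 0 := by have := hm 2 2; linarith
  have h33 : m 3 3 = 0 := by have := hm 3 3; linarith
  have h10 := hm 0 1
  have h20 := hm 0 2
  have h30 := hm 0 3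
  have h21 := hm 1 2
  have h31 := hm 1 3
  have h32 := hm 2 3
  have hε : ∀ a : Fin 4 → Fin 4, (leviCivita4 a : ℝ) =
      ((∏ i : Fin 4, ∏ j ∈ Finset.Ioi i, Int.sign ((a j : ℤ) - (a i : ℤ)) : ℤ) : ℝ) := fun a => rfl
  simp only [hε, Fin.sum_univ_four, Fin.prod_univ_four]
  simp only [show Finset.Ioi (0 : Fin 4) = {1, 2, 3} from by decide,
    show Finset.Ioi (1 : Fin 4) = {2, 3} from by decide,
    show Finset.Ioi (2 : Fin 4) = {3} from by decide,
    show Finset.Ioi (3 : Fin 4) = ∅ from by decide,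
    Finset.prod_insert (show (1 : Fin 4) ∉ ({2, 3} : Finset (Fin 4)) from by decide),
    Finset.prod_insert (show (2 : Fin 4) ∉ ({3} : Finset (Fin 4)) from by decide),
    Finset.prod_singleton, Finset.prod_empty, Matrix.cons_val_zero, Matrix.cons_val_one,
    Matrix.cons_val]
  norm_num [Fin.ext_iff, h00, h11, h22, h33, h10, h20, h30, h21, h31, h32]
  simp only [show Int.sign 2 = 1 from rfl, show Int.sign 3 = 1 from rfl]
  push_cast
  ring

/-- On the flux-sector field the density is the constant
`Σ ε_{μνρσ} (2π m_{μν}/L²)(2π m_{ρσ}/L²) = 8 (2π/L²)² (m₀₁m₂₃ − m₀₂m₁₃ + m₀₃m₁₂)`.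
[cite: Luscher1999AbelianChiral, §7.2; IgarashiOkuyamaSuzuki2002, eq. (3.4)] -/
theorem epsFF_fluxSectorField [NeZero L] (m : Fin 4 → Fin 4 → ℤ) (hm : ∀ μ ν, m ν μ = -m μ ν)
    (hb : ∀ μ ν, 2 * |(m μ ν : ℝ)| < (L : ℝ) ^ 2) (x : TorusSite 4 L) :
    epsFF (fluxSectorField L m) x =
      8 * (2 * Real.pi / (L : ℝ) ^ 2) ^ 2 *
        ((m 0 1 * m 2 3 - m 0 2 * m 1 3 + m 0 3 * m 1 2 : ℤ) : ℝ) := by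
  have hF : ∀ (y : TorusSite 4 L) (μ ν : Fin 4), abelianFieldTensor (fluxSectorField L m) y μ ν =
      2 * Real.pi / (L : ℝ) ^ 2 * (m μ ν : ℝ) := fun y μ ν => by
    rw [abelianFieldTensor_fluxSectorField m hm y μ ν (hb μ ν)]
    ring
  simp only [epsFF, hF]
  have hm' : ∀ μ ν, ((m ν μ : ℤ) : ℝ) = -((m μ ν : ℤ) : ℝ) := fun μ ν => by
    rw [hm μ ν]; push_cast; ring
  have key := sum_leviCivita4_mul_mul (fun μ ν => ((m μ ν : ℤ) : ℝ)) hm'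
  calc ∑ μ : Fin 4, ∑ ν : Fin 4, ∑ ρ : Fin 4, ∑ σ : Fin 4,
        (leviCivita4 ![μ, ν, ρ, σ] : ℝ) * (2 * Real.pi / (L : ℝ) ^ 2 * (m μ ν : ℝ)) *
          (2 * Real.pi / (L : ℝ) ^ 2 * (m ρ σ : ℝ))
      = (2 * Real.pi / (L : ℝ) ^ 2) ^ 2 * ∑ μ : Fin 4, ∑ ν : Fin 4, ∑ ρ : Fin 4, ∑ σ : Fin 4,
          (leviCivita4 ![μ, ν, ρ, σ] : ℝ) * (m μ ν : ℝ) * (m ρ σ : ℝ) := by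
        simp only [Finset.mul_sum]
        refine Finset.sum_congr rfl fun μ _ => Finset.sum_congr rfl fun ν _ =>
          Finset.sum_congr rfl fun ρ _ => Finset.sum_congr rfl fun σ _ => ?_
        ring
    _ = _ := by rw [key]; push_cast; ring

/-- **The `ε F F` charge of the flux sector `m`**: on `V_{[m]}`,
`(1/32π²) Σ_{x ∈ Γ} Σ ε_{μνρσ} F_{μν}(x) F_{ρσ}(x+μ̂+ν̂) = m₀₁ m₂₃ − m₀₂ m₁₃ + m₀₃ m₁₂` — the integer
on the right-hand side of `IOSFluxSectorIndex` (IOS (3.4) with `d = 4`: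
`(−1)^{d/2}/(2^{d/2}(d/2)!) · ε m m = (1/8) · 8 Q = Q`). [cite: IgarashiOkuyamaSuzuki2002, eq. (3.4)] -/
theorem sum_epsFF_fluxSectorField [NeZero L] (m : Fin 4 → Fin 4 → ℤ)
    (hm : ∀ μ ν, m ν μ = -m μ ν) (hb : ∀ μ ν, 2 * |(m μ ν : ℝ)| < (L : ℝ) ^ 2) :
    (32 * Real.pi ^ 2)⁻¹ * ∑ x : TorusSite 4 L, epsFF (fluxSectorField L m) x =
      ((m 0 1 * m 2 3 - m 0 2 * m 1 3 + m 0 3 * m 1 2 : ℤ) : ℝ) := by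
  simp only [epsFF_fluxSectorField m hm hb, Finset.sum_const, Finset.card_univ, nsmul_eq_mul]
  have hcard : (Fintype.card (TorusSite 4 L) : ℝ) = (L : ℝ) ^ 4 := by
    rw [Fintype.card_pi, Finset.prod_const, ZMod.card, Finset.card_univ, Fintype.card_fin]
    push_cast
    ring
  rw [hcard]
  have hL : (L : ℝ) ≠ 0 := Nat.cast_ne_zero.mpr (NeZero.ne L)
  have hπ : Real.pi ≠ 0 := Real.pi_ne_zero
  field_simp
  ring

end Charge

end Literature.MathematicalPhysics.QuantumLattice
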